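import Summits.CriticalPhenomena.PercolationContinuityZ3.Theorems.PercNearOneGluingNoHeavyLowerTailSahiOneStepFibreParam
import HarnessLib

/-!
# One-step scheme: explicit parametrisation of the THREE-copy fibres

Support file (prover prim-ineq-prove-3 gen 16; `--supports stmt-CriticalPhenomena-4575`; memo
`run/shared/lean/prim/prim-ineq-prove-3/FINDING-G16-FIBRE-MAJ5.md` §2.2, §3.6).  No definitions, no named facts, no sorries, no `native_decide`.

`…SahiOneStepFibre.osN_ind_ind_nonneg_of_fibre3` asks for the nonnegativity of the sum of `phi3 H A B` over each three-copy fibre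
`{(S₀,S₁,S₂) ∈ 𝒫(F)³ : key3 (S₀,S₁,S₂) = (I₃, I₂, J)}` (`I₃` = coordinates open in all three copies, `I₂` = open in at least two, `J` = open in at least one).
The fibre is empty unless `I₃ ⊆ I₂ ⊆ J ⊆ F` (`fibre3_filter_eq_empty`), and otherwise it is parametrised (`fibre3_sum_eq`) by quadruples
`(P₀, P₁, N₀, N₁)` with `P₀, P₁ ⊆ E₁ := J ∖ I₂` disjoint (the coordinates open ONLY in copy 0, resp. only in copy 1; the rest of `E₁` only in copy 2) and
`N₀, N₁ ⊆ E₂ := I₂ ∖ I₃` disjoint (the coordinates of `E₂` MISSING from copy 0, resp. from copy 1; the rest of `E₂` missing from copy 2):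
`S₀ = I₃ ∪ (E₂ ∖ N₀) ∪ P₀`, `S₁ = I₃ ∪ (E₂ ∖ N₁) ∪ P₁`, `S₂ = I₃ ∪ (N₀ ∪ N₁) ∪ (E₁ ∖ (P₀ ∪ P₁))`.  Hence the working form
`osN_ind_ind_nonneg_of_fibre3'` of the three-copy criterion.
-/

noncomputable section

namespace Summit.CriticalPhenomena.PercolationContinuityZ3.Theorems

namespace SahiOneStep

open MeasureTheory Finset
open Literature.Probability.Percolation (DeterminedBy)
open Literature.Probability.LatticeModels (prodBernoulli)
open Literature.Probability.Percolation.DecisionTree (ind)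
open scoped Classical

variable {ι : Type*} [Fintype ι] [DecidableEq ι]

omit [Fintype ι] in
/-- The key of a triple of `F`-patterns is a chain `I₃ ⊆ I₂ ⊆ J ⊆ F`. [this work] -/
theorem fibre3_filter_eq_empty (F : Finset ι) {I₃ I₂ J : Finset ι} (h : ¬ (I₃ ⊆ I₂ ∧ I₂ ⊆ J ∧ J ⊆ F)) :
    (F.powerset ×ˢ (F.powerset ×ˢ F.powerset)).filter (fun x => key3 x = (I₃, I₂, J)) = ∅ := by
  rw [Finset.filter_eq_empty_iff]
  intro x hx hk
  simp only [Finset.mem_product, Finset.mem_powerset] at hx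
  unfold key3 at hk
  rw [Prod.mk.injEq, Prod.mk.injEq] at hk
  obtain ⟨h3, h2, h1⟩ := hk
  apply h
  refine ⟨?_, ?_, ?_⟩
  · rw [← h3, ← h2]; intro i hi
    simp only [Finset.mem_inter] at hi; simp only [Finset.mem_union, Finset.mem_inter]
    exact Or.inl (Or.inl ⟨hi.1.1, hi.1.2⟩)
  · rw [← h2, ← h1]; intro i hi
    simp only [Finset.mem_union, Finset.mem_inter] at hi ⊢
    rcases hi with (⟨a, _⟩ | ⟨a, _⟩) | ⟨b, _⟩
    · exact Or.inl (Or.inl a)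
    · exact Or.inl (Or.inl a)
    · exact Or.inl (Or.inr b)
  · rw [← h1]; exact Finset.union_subset (Finset.union_subset hx.1 hx.2.1) hx.2.2

omit [Fintype ι] in
/-- **Parametrisation of a three-copy fibre** by the only-copy sets `P₀, P₁ ⊆ J ∖ I₂` and the missing-copy sets `N₀, N₁ ⊆ I₂ ∖ I₃`. [this work] -/
theorem fibre3_sum_eq (F : Finset ι) {I₃ I₂ J : Finset ι} (h32 : I₃ ⊆ I₂) (h2J : I₂ ⊆ J) (hJF : J ⊆ F)
    (f : Finset ι → Finset ι → Finset ι → ℝ) :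
    ∑ x ∈ (F.powerset ×ˢ (F.powerset ×ˢ F.powerset)).filter (fun x => key3 x = (I₃, I₂, J)), f x.1 x.2.1 x.2.2 =
      ∑ q ∈ (((J \ I₂).powerset ×ˢ (J \ I₂).powerset) ×ˢ ((I₂ \ I₃).powerset ×ˢ (I₂ \ I₃).powerset)).filter
          (fun q => Disjoint q.1.1 q.1.2 ∧ Disjoint q.2.1 q.2.2),
        f (I₃ ∪ ((I₂ \ I₃) \ q.2.1) ∪ q.1.1) (I₃ ∪ ((I₂ \ I₃) \ q.2.2) ∪ q.1.2)
          (I₃ ∪ (q.2.1 ∪ q.2.2) ∪ ((J \ I₂) \ (q.1.1 ∪ q.1.2))) := by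
  symm
  refine Finset.sum_nbij'
    (fun q => (I₃ ∪ ((I₂ \ I₃) \ q.2.1) ∪ q.1.1, I₃ ∪ ((I₂ \ I₃) \ q.2.2) ∪ q.1.2, I₃ ∪ (q.2.1 ∪ q.2.2) ∪ ((J \ I₂) \ (q.1.1 ∪ q.1.2))))
    (fun x => ((x.1 ∩ (J \ I₂), x.2.1 ∩ (J \ I₂)), ((I₂ \ I₃) \ x.1, (I₂ \ I₃) \ x.2.1))) ?_ ?_ ?_ ?_ ?_
  · -- the map lands in the fibre
    intro q hq
    simp only [Finset.mem_filter, Finset.mem_product, Finset.mem_powerset] at hq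
    obtain ⟨⟨⟨hP0, hP1⟩, hN0, hN1⟩, hdP, hdN⟩ := hq
    have p0 : ∀ i, i ∈ q.1.1 → i ∈ J ∧ i ∉ I₂ := fun i h => Finset.mem_sdiff.1 (hP0 h)
    have p1 : ∀ i, i ∈ q.1.2 → i ∈ J ∧ i ∉ I₂ := fun i h => Finset.mem_sdiff.1 (hP1 h)
    have n0 : ∀ i, i ∈ q.2.1 → i ∈ I₂ ∧ i ∉ I₃ := fun i h => Finset.mem_sdiff.1 (hN0 h)
    have n1 : ∀ i, i ∈ q.2.2 → i ∈ I₂ ∧ i ∉ I₃ := fun i h => Finset.mem_sdiff.1 (hN1 h)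
    have dP : ∀ i, i ∈ q.1.1 → i ∉ q.1.2 := fun i h h' => Finset.disjoint_left.1 hdP h h'
    have dN : ∀ i, i ∈ q.2.1 → i ∉ q.2.2 := fun i h h' => Finset.disjoint_left.1 hdN h h'
    have s32 : ∀ i, i ∈ I₃ → i ∈ I₂ := fun i h => h32 h
    have s2J : ∀ i, i ∈ I₂ → i ∈ J := fun i h => h2J h
    simp only [Finset.mem_filter, Finset.mem_product, Finset.mem_powerset]
    refine ⟨⟨?_, ?_, ?_⟩, ?_⟩
    · intro i hi; simp only [Finset.mem_union, Finset.mem_sdiff] at hi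
      have := p0 i; have := s32 i; have := s2J i
      exact hJF (by grind)
    · intro i hi; simp only [Finset.mem_union, Finset.mem_sdiff] at hi
      have := p1 i; have := s32 i; have := s2J i
      exact hJF (by grind)
    · intro i hi; simp only [Finset.mem_union, Finset.mem_sdiff] at hi
      have := n0 i; have := n1 i; have := s32 i; have := s2J i
      exact hJF (by grind)
    · unfold key3
      simp only [Prod.mk.injEq]
      refine ⟨?_, ?_, ?_⟩ <;>
      · ext i
        simp only [Finset.mem_inter, Finset.mem_union, Finset.mem_sdiff]
        have := p0 i; have := p1 i; have := n0 i; have := n1 i; have := dP i; have := dN i; have := s32 i; have := s2J i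
        grind
  · -- the inverse map lands in the parameter set
    intro x hx
    simp only [Finset.mem_filter, Finset.mem_product, Finset.mem_powerset] at hx
    obtain ⟨-, hk⟩ := hx
    unfold key3 at hk
    simp only [Prod.mk.injEq] at hk
    obtain ⟨h3, h2, h1⟩ := hk
    simp only [Finset.mem_filter, Finset.mem_product, Finset.mem_powerset]
    refine ⟨⟨⟨Finset.inter_subset_right, Finset.inter_subset_right⟩, Finset.sdiff_subset, Finset.sdiff_subset⟩, ?_, ?_⟩
    · rw [Finset.disjoint_left]
      intro i ha hb
      simp only [Finset.mem_inter, Finset.mem_sdiff] at ha hb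
      have e2 := (Finset.ext_iff.1 h2 i)
      simp only [Finset.mem_union, Finset.mem_inter] at e2
      exact ha.2.2 (e2.1 (Or.inl (Or.inl ⟨ha.1, hb.1⟩)))
    · rw [Finset.disjoint_left]
      intro i ha hb
      simp only [Finset.mem_sdiff] at ha hb
      have e2 := (Finset.ext_iff.1 h2 i)
      simp only [Finset.mem_union, Finset.mem_inter] at e2
      have := e2.2 ha.1.1
      grind
  · -- left inverse
    intro q hq
    simp only [Finset.mem_filter, Finset.mem_product, Finset.mem_powerset] at hq
    obtain ⟨⟨⟨hP0, hP1⟩, hN0, hN1⟩, hdP, hdN⟩ := hq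
    have p0 : ∀ i, i ∈ q.1.1 → i ∈ J ∧ i ∉ I₂ := fun i h => Finset.mem_sdiff.1 (hP0 h)
    have p1 : ∀ i, i ∈ q.1.2 → i ∈ J ∧ i ∉ I₂ := fun i h => Finset.mem_sdiff.1 (hP1 h)
    have n0 : ∀ i, i ∈ q.2.1 → i ∈ I₂ ∧ i ∉ I₃ := fun i h => Finset.mem_sdiff.1 (hN0 h)
    have n1 : ∀ i, i ∈ q.2.2 → i ∈ I₂ ∧ i ∉ I₃ := fun i h => Finset.mem_sdiff.1 (hN1 h)
    have s32 : ∀ i, i ∈ I₃ → i ∈ I₂ := fun i h => h32 h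
    obtain ⟨⟨P0, P1⟩, N0, N1⟩ := q
    simp only [Prod.mk.injEq]
    refine ⟨⟨?_, ?_⟩, ?_, ?_⟩ <;>
    · ext i
      simp only [Finset.mem_inter, Finset.mem_union, Finset.mem_sdiff]
      have := p0 i; have := p1 i; have := n0 i; have := n1 i; have := s32 i
      grind
  · -- right inverse
    intro x hx
    simp only [Finset.mem_filter, Finset.mem_product, Finset.mem_powerset] at hx
    obtain ⟨⟨hx0, hx1, hx2⟩, hk⟩ := hx
    unfold key3 at hk
    simp only [Prod.mk.injEq] at hk
    obtain ⟨h3, h2, h1⟩ := hk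
    have s32 : ∀ i, i ∈ I₃ → i ∈ I₂ := fun i h => h32 h
    have s2J : ∀ i, i ∈ I₂ → i ∈ J := fun i h => h2J h
    obtain ⟨S0, S1, S2⟩ := x
    simp only [Prod.mk.injEq]
    refine ⟨?_, ?_, ?_⟩ <;>
    · ext i
      have e3 := Finset.ext_iff.1 h3 i; have e2 := Finset.ext_iff.1 h2 i; have e1 := Finset.ext_iff.1 h1 i
      simp only [Finset.mem_inter, Finset.mem_union, Finset.mem_sdiff] at e3 e2 e1 ⊢
      have := s32 i; have := s2J i
      grind
  · intro q hq; rfl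

/-- **Working form of the three-copy fibre criterion.**  If for all chains `I₃ ⊆ I₂ ⊆ J ⊆ F` the parametrised fibre sum of `φ₃` is nonnegative, then
`n(H;A,B) ≥ 0`. [this work] -/
theorem osN_ind_ind_nonneg_of_fibre3' (p : ι → unitInterval) {F : Finset ι} {H A B : Set (Set ι)} (hH : DeterminedBy H (↑F : Set ι))
    (hA : DeterminedBy A (↑F : Set ι)) (hB : DeterminedBy B (↑F : Set ι))
    (hfib : ∀ I₃ I₂ J : Finset ι, I₃ ⊆ I₂ → I₂ ⊆ J → J ⊆ F →
      0 ≤ ∑ q ∈ (((J \ I₂).powerset ×ˢ (J \ I₂).powerset) ×ˢ ((I₂ \ I₃).powerset ×ˢ (I₂ \ I₃).powerset)).filter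
          (fun q => Disjoint q.1.1 q.1.2 ∧ Disjoint q.2.1 q.2.2),
        phi3 H A B (I₃ ∪ ((I₂ \ I₃) \ q.2.1) ∪ q.1.1) (I₃ ∪ ((I₂ \ I₃) \ q.2.2) ∪ q.1.2)
          (I₃ ∪ (q.2.1 ∪ q.2.2) ∪ ((J \ I₂) \ (q.1.1 ∪ q.1.2)))) :
    0 ≤ osN p H (ind A) (ind B) := by
  refine osN_ind_ind_nonneg_of_fibre3 p hH hA hB fun K => ?_
  obtain ⟨I₃, I₂, J⟩ := K
  by_cases h : I₃ ⊆ I₂ ∧ I₂ ⊆ J ∧ J ⊆ F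
  · rw [fibre3_sum_eq F h.1 h.2.1 h.2.2 (phi3 H A B)]
    exact hfib I₃ I₂ J h.1 h.2.1 h.2.2
  · rw [fibre3_filter_eq_empty F h, Finset.sum_empty]

end SahiOneStep

end Summit.CriticalPhenomena.PercolationContinuityZ3.Theorems
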